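import Summits.CriticalPhenomena.PercolationContinuityZ3.Theorems.PercNearOneGluingNoHeavyQuantFarSunLaw
import Summits.CriticalPhenomena.PercolationContinuityZ3.Theorems.PercNearOneGluingNoHeavyQuantFarHairyCycleD
import HarnessLib

/-!
# FAR beyond trees: `HairyCycle.SunFAR K j` ⟹ the body of `Quant.FarRelayRow` at layer `j` on EVERY hairy cycle / ring with `K` relays
# (all cycle lengths, all weights) — the law-level row transported by the segment reduction

builds on p205010 (kernel theorem, internal audit signed; external expert review pending)

Support file (`--supports stmt-CriticalPhenomena-4575`), seat `prim-cert-1` (gen 20); QUANT lane rung R8, front "FAR beyond trees" (lead g22).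
`HairyCycle.SunFAR K j` (`…QuantFarSunLawDefs`) is the ELEMENTARY form of FAR at layer `j` on the sun graph `C_{K+1}` (a finite real inequality in the
cycle-edge weights `g m` and hair weights `h k`, through the explicit functional `sunLaw`); `HairyCycle.farp_sun_of_sunFAR` (`…QuantFarSunLaw`) turns it
into `TwoCopy.FARp` on the sun graph for every weight function, and the SEGMENT REDUCTIONS `HairyCycle.farp_of_sun` / `farp_of_sunD` (gen 18) carry
that to every hairy cycle (pendant relays; `IsHairyCycle`) and every ring (relays at cycle vertices and/or pendant; `IsHairyCycleD`).  Hence: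

* `farp_hairyCycle_of_sunFAR`, `farRelayRow_hairyCycle_of_sunFAR` — **`SunFAR K j` ⟹ for every hairy cycle `c_0 = o, …, c_{L−1}` (`L ≥ 3`) with `K`
  pendant relays, every weight function supported on its pairs, every `t`: `2j < Σ_k P(c_0 ↔ t_k)` and `P(c_0 ↮ t_k) ≤ t` (`k < K`) imply
  `P(#{k : c_0 ↔ t_k} ≤ j) ≤ t`** — the body of `Quant.FarRelayRow` for these supports and relay sets;
* `farp_ring_of_sunFAR`, `farRelayRow_ring_of_sunFAR` — the same for rings (`IsHairyCycleD`: relay `k` is the cycle vertex `c_{b_k}` itself or a pendant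
  tip attached to it);
* `farRelayRow_hairyCycle_of_forall_sunFAR` — all layers at once.
So a proof of `SunFAR K 1` for every `K` (the layer-one programme of prim-quant-p1 g15/g16: two-arc lemmas in the two-chain model) lands verbatim as
"FAR at layer one on every hairy cycle"; `SunFAR K j` for `K ≤ 7` is in the kernel through the sun certificates (`…QuantFarSunRowLeSeven`).
No sorries; standard axioms.  [cite: KozmaNitzan2024, Conjecture 3 (p. 15)] (the row); [cite: Grimmett1999, §1.3 p. 10] (product measure); [this work].
-/

noncomputable section

namespace Summit.CriticalPhenomena.PercolationContinuityZ3.Theorems.HairyCycle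

open Finset MeasureTheory
open Literature.Probability.Percolation Literature.Probability.LatticeModels
open Summit.CriticalPhenomena.PercolationContinuityZ3.Theorems.AdditiveGluing.Negative.Cert
open Summit.CriticalPhenomena.PercolationContinuityZ3.Theorems.TwoCopy
open scoped Classical

variable {n : ℕ} {L : ℕ} {cyc : ℕ → Fin n} {K : ℕ} {base : ℕ → ℕ} {tip : ℕ → Fin n}

/-! ## Hairy cycles (pendant relays) -/

/-- **`SunFAR K j` ⟹ the FAR instance at layer `j` on every hairy cycle with `K` hairs.** [this work] -/
theorem farp_hairyCycle_of_sunFAR (H : IsHairyCycle L cyc K base tip) {j : ℕ} (hS : SunFAR K j)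
    (w : Sym2 (Fin n) → unitInterval)
    (hsupp : ∀ e : Sym2 (Fin n), ¬ e.IsDiag → w e ≠ 0 →
      (∃ i, i < L ∧ e = cycE L cyc i) ∨ (∃ k, k < K ∧ e = hairE cyc base tip k)) :
    FARp w ((Finset.range K).image tip) (cyc 0) j :=
  farp_of_sun H j (fun q hq => farp_sun_of_sunFAR H.hK hS q hq) w hsupp

/-- **`SunFAR K j` ⟹ `Quant.FarRelayRow`'s body at layer `j` ON EVERY HAIRY CYCLE WITH `K` PENDANT RELAYS** (cycle `c_0 = o, c_1, …, c_{L−1}`,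
`L ≥ 3`, hairs `s(c_{b_k}, t_k)`, any weight function whose non-loop support lies on these pairs): `2j < Σ_{k<K} P(c_0 ↔ t_k)` and
`P(c_0 ↮ t_k) ≤ t` for all `k < K` imply `P(#{k < K : c_0 ↔ t_k} ≤ j) ≤ t`. [this work] -/
theorem farRelayRow_hairyCycle_of_sunFAR (H : IsHairyCycle L cyc K base tip) {j : ℕ} (hS : SunFAR K j)
    (w : Sym2 (Fin n) → unitInterval)
    (hsupp : ∀ e : Sym2 (Fin n), ¬ e.IsDiag → w e ≠ 0 →
      (∃ i, i < L ∧ e = cycE L cyc i) ∨ (∃ k, k < K ∧ e = hairE cyc base tip k))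
    (t : ℝ)
    (hEN : (2 * j : ℝ) < ∑ a ∈ (Finset.range K).image tip, (prodBernoulli w).real (openConn (cyc 0) a))
    (hcut : ∀ a ∈ (Finset.range K).image tip, (prodBernoulli w).real (openConn (cyc 0) a)ᶜ ≤ t) :
    (prodBernoulli w).real {ω : BondConfig (Fin n) |
      (((Finset.range K).image tip).filter fun a => ω ∈ openConn (cyc 0) a).card ≤ j} ≤ t :=
  farp_hairyCycle_of_sunFAR H hS w hsupp hEN t hcut

/-- **All layers at once**: `(∀ j, SunFAR K j)` ⟹ `Quant.FarRelayRow`'s body at every layer on every hairy cycle with `K` pendant relays. [this work] -/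
theorem farRelayRow_hairyCycle_of_forall_sunFAR (H : IsHairyCycle L cyc K base tip) (hS : ∀ j, SunFAR K j)
    (w : Sym2 (Fin n) → unitInterval)
    (hsupp : ∀ e : Sym2 (Fin n), ¬ e.IsDiag → w e ≠ 0 →
      (∃ i, i < L ∧ e = cycE L cyc i) ∨ (∃ k, k < K ∧ e = hairE cyc base tip k))
    (j : ℕ) (t : ℝ)
    (hEN : (2 * j : ℝ) < ∑ a ∈ (Finset.range K).image tip, (prodBernoulli w).real (openConn (cyc 0) a))
    (hcut : ∀ a ∈ (Finset.range K).image tip, (prodBernoulli w).real (openConn (cyc 0) a)ᶜ ≤ t) :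
    (prodBernoulli w).real {ω : BondConfig (Fin n) |
      (((Finset.range K).image tip).filter fun a => ω ∈ openConn (cyc 0) a).card ≤ j} ≤ t :=
  farRelayRow_hairyCycle_of_sunFAR H (hS j) w hsupp t hEN hcut

/-! ## Rings (relays at cycle vertices and/or pendant) -/

/-- **`SunFAR K j` ⟹ the FAR instance at layer `j` on every ring with `K` relays** (`IsHairyCycleD`). [this work] -/
theorem farp_ring_of_sunFAR (H : IsHairyCycleD L cyc K base tip) {j : ℕ} (hS : SunFAR K j)
    (w : Sym2 (Fin n) → unitInterval)
    (hsupp : ∀ e : Sym2 (Fin n), ¬ e.IsDiag → w e ≠ 0 →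
      (∃ i, i < L ∧ e = cycE L cyc i) ∨ (∃ k, k < K ∧ e = hairE cyc base tip k)) :
    FARp w ((Finset.range K).image tip) (cyc 0) j :=
  farp_of_sunD H j (fun q hq => farp_sun_of_sunFAR H.hK hS q hq) w hsupp

/-- **`SunFAR K j` ⟹ `Quant.FarRelayRow`'s body at layer `j` ON EVERY RING WITH `K` RELAYS** (cycle `c_0 = o, …, c_{L−1}`, relay `k` = the cycle
vertex `c_{b_k}` or a pendant tip `t_k` attached to it; weights supported on the cycle edges and the proper hair edges). [this work] -/
theorem farRelayRow_ring_of_sunFAR (H : IsHairyCycleD L cyc K base tip) {j : ℕ} (hS : SunFAR K j)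
    (w : Sym2 (Fin n) → unitInterval)
    (hsupp : ∀ e : Sym2 (Fin n), ¬ e.IsDiag → w e ≠ 0 →
      (∃ i, i < L ∧ e = cycE L cyc i) ∨ (∃ k, k < K ∧ e = hairE cyc base tip k))
    (t : ℝ)
    (hEN : (2 * j : ℝ) < ∑ a ∈ (Finset.range K).image tip, (prodBernoulli w).real (openConn (cyc 0) a))
    (hcut : ∀ a ∈ (Finset.range K).image tip, (prodBernoulli w).real (openConn (cyc 0) a)ᶜ ≤ t) :
    (prodBernoulli w).real {ω : BondConfig (Fin n) |
      (((Finset.range K).image tip).filter fun a => ω ∈ openConn (cyc 0) a).card ≤ j} ≤ t :=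
  farp_ring_of_sunFAR H hS w hsupp hEN t hcut

end Summit.CriticalPhenomena.PercolationContinuityZ3.Theorems.HairyCycle

end
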